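import Mathlib
import Summits.ValiantsHypothesis.ValiantsHypothesis.Theses.ValuativeGCT
import Summits.ValiantsHypothesis.ValiantsHypothesis.Theorems.ValuativeGCTValuativeFlipBinaryFormsDeterminantal
import Summits.ValiantsHypothesis.ValiantsHypothesis.Theorems.ValuativeGCTNoValuativeFlipBoundedLength
import Summits.ValiantsHypothesis.ValiantsHypothesis.Theorems.ValuativeGCTValuativeBound

/-!
# No valuative flip on shapes with at most two rows (few-row plethysm table, rows 1–2)

Crux `ValuativeGCT.ValuativeFlip` (stmt-ValiantsHypothesis-12624), wall-breaker axis 14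
("plethysm tables, small cases certified"), in support of line `four-row-count`; second file
(over `ValuativeGCTValuativeFlipBinaryFormsDeterminantal`).

On a shape `λ ⊢ mδ` with at most `k` rows both sides of the crux inequality only see the `k`
greatest letters of `MatIdx m` (the dual weight `λ*` vanishes elsewhere,
`NoValuativeFlip.dualOfPartition_toMatIdx_eq_zero_of_lt`).  For `k ≤ 2` the determinant side is
everything (`orbitMultiplicity_le_det_of_card_le_two`: `Det_m` majorises every orbit closure on two
letters), so `mult_{λ*} ℂ[Δ_m(X₀₀^{m-n} per_n)] ≤ K_m(λ*)` for `ℓ(λ) ≤ 2` at EVERY `n ≤ m`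
(`orbitMultiplicity_paddedPer_le_det_of_card_parts_le_two`; no largeness of `m`, in contrast with
the bounded-length no-go `orbitMultiplicity_paddedPer_le_det_of_card_parts`, which needs
`m ≥ 1 + n(n+1)^ℓ(λ)`).  With the landed `ValuativeBound_proof` (`K_m(λ*) ≤ dim T_U(λ)` for every
admissible centre): `no_twoRow_flip` — the crux's truncation `T_U(λ)` (verbatim) is never below
`mult_pp(λ*)` when `ℓ(λ) ≤ 2`; every `ValuativeFlip` / `HeadFlip` witness has at least THREE rows
(`three_le_card_parts_of_flip`).  This extends Disproof F5b (one row) by one row; the three-row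
entry of the table is the classical theorem that ternary forms are determinantal (Dickson 1921 /
Beauville 2000, not in the tree); four rows is where line `four-row-count` lives.

References: BLMW, SIAM J. Comput. 40 (2011) §5.3; J. M. Landsberg, *Geometry and Complexity
Theory* (2017) §6.8, §8.4; A. Beauville, Michigan Math. J. 48 (2000).
-/

set_option linter.dupNamespace false

noncomputable section

namespace Summit.ValiantsHypothesis.ValiantsHypothesis.Theorems.ValuativeFlip

open MvPolynomial
open scoped BigOperators Matrix
open Literature.NumberTheory.DiophantineGeometry Literature.Computability.AlgebraicComplexity
open Summit.ValiantsHypothesis.ValiantsHypothesis.Theses.ValuativeGCT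


/-! ## Shapes with at most two rows: no multiplicity obstruction, no valuative flip -/

section TwoRows

/-- **No multiplicity obstruction on shapes with at most two rows, at any padding.** For `n ≤ m`
and `λ ⊢ mδ` with `ℓ(λ) ≤ 2` (and `ℓ(λ) ≤ m²`): `mult_{λ*} ℂ[Δ_m(X₀₀^{m-n} per_n)] ≤ K_m(λ*)`.
The dual weight `λ*` lives on the last `ℓ(λ) ≤ 2` lexicographic letters
(`NoValuativeFlip.dualOfPartition_toMatIdx_eq_zero_of_lt`). BLMW 2011 §5.3. -/
theorem orbitMultiplicity_paddedPer_le_det_of_card_parts_le_two {n m : ℕ} [NeZero m] (hnm : n ≤ m)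
    {δ : ℕ} (lam : Nat.Partition (m * δ)) (h2 : lam.parts.card ≤ 2) (hcard : lam.parts.card ≤ m * m) :
    orbitMultiplicity ℂ (paddedPerFormLex ℂ n m) m (Weight.dualOfPartition (m * m) lam).toMatIdx ≤
      orbitMultiplicity ℂ (detFormLex ℂ m) m (Weight.dualOfPartition (m * m) lam).toMatIdx := by
  classical
  set ρ := lam.parts.card with hρ
  -- the last `ρ` lexicographic positions
  let S : Finset (MatIdx m) := Finset.univ.image fun t : Fin ρ =>
    matIdxEquiv m ⟨m * m - 1 - t, by have := t.2; omega⟩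
  have hScard : S.card ≤ 2 := Finset.card_image_le.trans (by simpa using h2)
  have hχ : ∀ i, i ∉ S → (Weight.dualOfPartition (m * m) lam).toMatIdx i = 0 := by
    intro i hi
    obtain ⟨i', rfl⟩ : ∃ i' : Fin (m * m), matIdxEquiv m i' = i :=
      ⟨(matIdxEquiv m).symm i, (matIdxEquiv m).apply_symm_apply i⟩
    by_cases hlt : (i' : ℕ) + ρ < m * m
    · exact NoValuativeFlip.dualOfPartition_toMatIdx_eq_zero_of_lt lam i' hlt
    · exfalso
      apply hi
      refine Finset.mem_image.mpr ⟨⟨m * m - 1 - i', by omega⟩, Finset.mem_univ _, ?_⟩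
      congr 1
      exact Fin.ext (by simp; omega)
  exact orbitMultiplicity_le_det_of_card_le_two (paddedPerFormLex_isHomogeneous (k := ℂ) hnm) S
    hScard _ hχ

/-- **No valuative flip on shapes with at most two rows.** For every `n ≤ m`, every centre `(U, r)`
with ranks `≤ r` on `U`, every `δ` and every `λ ⊢ mδ` with at most two rows (and `ℓ(λ) ≤ m²`), the
crux's truncation `T_U(λ)` (verbatim body of `ValuativeGCT.ValuativeFlip`) satisfies
`mult_pp(λ*) ≤ dim T_U(λ)` — the `ValuativeFlip` inequality `dim T_U(λ) < mult_pp(λ*)` fails.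
Composition of `orbitMultiplicity_paddedPer_le_det_of_card_parts_le_two` with the landed
`ValuativeBound_proof` (stmt-ValiantsHypothesis-12625). Unconditional. -/
theorem no_twoRow_flip {n : ℕ} (m : ℕ) [NeZero m] (hnm : n ≤ m)
    (U : Submodule ℂ (MatIdx m → ℂ)) (r : ℕ)
    (hU : ∀ u ∈ U, (Matrix.of fun a b : Fin m => u (toLex (a, b))).rank ≤ r)
    (δ : ℕ) (lam : Nat.Partition (m * δ)) (h2 : lam.parts.card ≤ 2) (hcard : lam.parts.card ≤ m * m) :
    let χ : Literature.NumberTheory.DiophantineGeometry.Weight (Literature.NumberTheory.DiophantineGeometry.MatIdx m) := (Literature.NumberTheory.DiophantineGeometry.Weight.dualOfPartition (m * m) lam).toMatIdx; let T : Submodule ℂ (MvPolynomial (Literature.NumberTheory.DiophantineGeometry.MatIdx m × Literature.NumberTheory.DiophantineGeometry.MatIdx m) ℂ) := MvPolynomial.homogeneousSubmodule (Literature.NumberTheory.DiophantineGeometry.MatIdx m × Literature.NumberTheory.DiophantineGeometry.MatIdx m) ℂ (m * δ) ⊓ ((MvPolynomial.vanishingIdeal ℂ {p : Literature.NumberTheory.DiophantineGeometry.MatIdx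 m × Literature.NumberTheory.DiophantineGeometry.MatIdx m → ℂ | ∀ j : Literature.NumberTheory.DiophantineGeometry.MatIdx m, (fun i => p (j, i)) ∈ U}) ^ (δ * (m - r))).restrictScalars ℂ ⊓ (⨅ (M : Matrix (Literature.NumberTheory.DiophantineGeometry.MatIdx m) (Literature.NumberTheory.DiophantineGeometry.MatIdx m) ℂ) (_ : Literature.Computability.AlgebraicComplexity.linSubst (Literature.NumberTheory.DiophantineGeometry.MatIdx m) ℂ M (Literature.NumberTheory.DiophantineGeometry.detFormLex ℂ m) = Literature.NumberTheory.DiophantineGeometry.detFormLex ℂ m), LinearMap.ker ((MvPolynomial.aeval (R := ℂ) fun p : Literature.NumberTheory.DiophantineGeometry.MatIdx m × Literature.NumberTheory.DiophantineGeometry.MatIdx m => ∑ l : Literature.NumberTheory.DiophantineGeometry.MatIdx m, M l p.2 • MvPolynomial.X (p.1, l)).toLinearMap - LinearMap.id (R := ℂ) (M := MvPolynomial (Literature.NumberTheory.DiophantineGeometry.MatIdx m × Literature.NumberTheory.DiophantineGeometry.MatIdx m) ℂ))) ⊓ (⨅ (g : Matrix.GeneralLinearGroup (Literature.NumberTheory.DiophantineGeometry.MatIdx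 m) ℂ) (_ : Literature.NumberTheory.DiophantineGeometry.IsUpperTriangular g), LinearMap.ker ((MvPolynomial.aeval (R := ℂ) fun p : Literature.NumberTheory.DiophantineGeometry.MatIdx m × Literature.NumberTheory.DiophantineGeometry.MatIdx m => ∑ l : Literature.NumberTheory.DiophantineGeometry.MatIdx m, ((g⁻¹ : Matrix.GeneralLinearGroup (Literature.NumberTheory.DiophantineGeometry.MatIdx m) ℂ) : Matrix (Literature.NumberTheory.DiophantineGeometry.MatIdx m) (Literature.NumberTheory.DiophantineGeometry.MatIdx m) ℂ) p.1 l • MvPolynomial.X (l, p.2)).toLinearMap - Literature.NumberTheory.DiophantineGeometry.weightChar χ g • LinearMap.id (R := ℂ) (M := MvPolynomial (Literature.NumberTheory.DiophantineGeometry.MatIdx m × Literature.NumberTheory.DiophantineGeometry.MatIdx m) ℂ))); Literature.NumberTheory.DiophantineGeometry.orbitMultiplicity ℂ (Literature.NumberTheory.DiophantineGeometry.paddedPerFormLex ℂ n m) m χ ≤ Module.finrank ℂ ↥T := by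
  intro χ T
  exact (orbitMultiplicity_paddedPer_le_det_of_card_parts_le_two hnm lam h2 hcard).trans
    (ValuativeBound.ValuativeBound_proof m U r hU δ lam hcard)

/-- **Every valuative-flip witness has at least three rows.** If the crux's inequality
`dim T_U(λ) < mult_pp(λ*)` holds at some admissible `(n, m, U, r, δ, λ)` (`n ≤ m`, ranks `≤ r` on
`U`, `ℓ(λ) ≤ m²`), then `3 ≤ ℓ(λ)`. In particular the four-row shapes produced by line
`four-row-count` (`stub_fourRowBridge`) have exactly three or four rows. -/
theorem three_le_card_parts_of_flip {n : ℕ} (m : ℕ) [NeZero m] (hnm : n ≤ m)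
    (U : Submodule ℂ (MatIdx m → ℂ)) (r : ℕ)
    (hU : ∀ u ∈ U, (Matrix.of fun a b : Fin m => u (toLex (a, b))).rank ≤ r)
    (δ : ℕ) (lam : Nat.Partition (m * δ)) (hcard : lam.parts.card ≤ m * m)
    (hflip : let χ : Literature.NumberTheory.DiophantineGeometry.Weight (Literature.NumberTheory.DiophantineGeometry.MatIdx m) := (Literature.NumberTheory.DiophantineGeometry.Weight.dualOfPartition (m * m) lam).toMatIdx; let T : Submodule ℂ (MvPolynomial (Literature.NumberTheory.DiophantineGeometry.MatIdx m × Literature.NumberTheory.DiophantineGeometry.MatIdx m) ℂ) := MvPolynomial.homogeneousSubmodule (Literature.NumberTheory.DiophantineGeometry.MatIdx m × Literature.NumberTheory.DiophantineGeometry.MatIdx m) ℂ (m * δ) ⊓ ((MvPolynomial.vanishingIdeal ℂ {p : Literature.NumberTheory.DiophantineGeometry.MatIdx m × Literature.NumberTheory.DiophantineGeometry.MatIdx m → ℂ | ∀ j : Literature.NumberTheory.DiophantineGeometry.MatIdx m, (fun i => p (j, i)) ∈ U}) ^ (δ * (m - r))).restrictScalars ℂ ⊓ (⨅ (M : Matrix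 (Literature.NumberTheory.DiophantineGeometry.MatIdx m) (Literature.NumberTheory.DiophantineGeometry.MatIdx m) ℂ) (_ : Literature.Computability.AlgebraicComplexity.linSubst (Literature.NumberTheory.DiophantineGeometry.MatIdx m) ℂ M (Literature.NumberTheory.DiophantineGeometry.detFormLex ℂ m) = Literature.NumberTheory.DiophantineGeometry.detFormLex ℂ m), LinearMap.ker ((MvPolynomial.aeval (R := ℂ) fun p : Literature.NumberTheory.DiophantineGeometry.MatIdx m × Literature.NumberTheory.DiophantineGeometry.MatIdx m => ∑ l : Literature.NumberTheory.DiophantineGeometry.MatIdx m, M l p.2 • MvPolynomial.X (p.1, l)).toLinearMap - LinearMap.id (R := ℂ) (M := MvPolynomial (Literature.NumberTheory.DiophantineGeometry.MatIdx m × Literature.NumberTheory.DiophantineGeometry.MatIdx m) ℂ))) ⊓ (⨅ (g : Matrix.GeneralLinearGroup (Literature.NumberTheory.DiophantineGeometry.MatIdx m) ℂ) (_ : Literature.NumberTheory.DiophantineGeometry.IsUpperTriangular g), LinearMap.ker ((MvPolynomial.aeval (R := ℂ) fun p : Literature.NumberTheory.DiophantineGeometry.MatIdx m × Literature.NumberTheory.DiophantineGeometry.MatIdx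 m => ∑ l : Literature.NumberTheory.DiophantineGeometry.MatIdx m, ((g⁻¹ : Matrix.GeneralLinearGroup (Literature.NumberTheory.DiophantineGeometry.MatIdx m) ℂ) : Matrix (Literature.NumberTheory.DiophantineGeometry.MatIdx m) (Literature.NumberTheory.DiophantineGeometry.MatIdx m) ℂ) p.1 l • MvPolynomial.X (l, p.2)).toLinearMap - Literature.NumberTheory.DiophantineGeometry.weightChar χ g • LinearMap.id (R := ℂ) (M := MvPolynomial (Literature.NumberTheory.DiophantineGeometry.MatIdx m × Literature.NumberTheory.DiophantineGeometry.MatIdx m) ℂ))); Module.finrank ℂ ↥T < Literature.NumberTheory.DiophantineGeometry.orbitMultiplicity ℂ (Literature.NumberTheory.DiophantineGeometry.paddedPerFormLex ℂ n m) m χ) :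
    3 ≤ lam.parts.card := by
  by_contra h
  exact absurd hflip (not_lt.mpr (no_twoRow_flip m hnm U r hU δ lam (by omega) hcard))

end TwoRows

/-! ## Row `k` of the table, conditionally: if every `k`-letter form is border-determinantal -/

section TopForms

/-- **The few-row table, row `k`, det column as a hypothesis.** Let `k ≤ m²` and suppose every
form of degree `m` in the `k` greatest lexicographic letters of `MatIdx m` (the letters `i` with
`m² ≤ idx(i) + k`, the skeleton's "kept" letters for `k = 4`) lies in `Δ(det_m)` — true for
`k ≤ 2` (`mem_orbitClosure_detFormLex_of_vars_subset_pair`), classically true for `k = 3`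
(ternary forms are determinantal: Dickson 1921, Beauville 2000; not in the tree), false for
`k = 4 ≤ m` by dimension. Then for every weight `χ` vanishing off those letters,
`mult_χ ℂ[Δ_m(X₀₀^{m-n} per_n)] ≤ K_m(χ)` (support transfer). -/
theorem orbitMultiplicity_paddedPer_le_det_of_topForms_mem_orbitClosure {n m : ℕ} [NeZero m]
    (hnm : n ≤ m) (k : ℕ)
    (H : ∀ q : MvPolynomial (MatIdx m) ℂ, q.IsHomogeneous m →
      (∀ i ∈ q.vars, m * m ≤ (((matIdxEquiv m).symm i : Fin (m * m)) : ℕ) + k) →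
        q ∈ orbitClosure (detFormLex ℂ m))
    (χ : Weight (MatIdx m)) (hχ : ∀ i, ¬ m * m ≤ (((matIdxEquiv m).symm i : Fin (m * m)) : ℕ) + k → χ i = 0) :
    orbitMultiplicity ℂ (paddedPerFormLex ℂ n m) m χ ≤ orbitMultiplicity ℂ (detFormLex ℂ m) m χ := by
  classical
  let S : Finset (MatIdx m) :=
    Finset.univ.filter fun i => m * m ≤ (((matIdxEquiv m).symm i : Fin (m * m)) : ℕ) + k
  have hS : ∀ i, i ∉ S → ¬ m * m ≤ (((matIdxEquiv m).symm i : Fin (m * m)) : ℕ) + k := by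
    intro i hi h
    exact hi (Finset.mem_filter.mpr ⟨Finset.mem_univ _, h⟩)
  refine NoValuativeFlip.orbitMultiplicity_le_of_weight_support (detFormLex ℂ m)
    (paddedPerFormLex ℂ n m) (NeZero.ne m) S (fun A hA => ?_) χ (fun i hi => hχ i (hS i hi))
  refine H _ (linSubst_isHomogeneous A (paddedPerFormLex_isHomogeneous (k := ℂ) hnm)) ?_
  intro i hi
  have hsub : ↑(linSubst (MatIdx m) ℂ A (paddedPerFormLex ℂ n m)).vars ⊆ (↑S : Set (MatIdx m)) :=
    vars_linSubst_subset (A := Finset.univ) A (fun x l _ hx => hA x (fun hxS => hx hxS) l) (by simp)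
  exact (Finset.mem_filter.mp (hsub (Finset.mem_coe.mpr hi))).2

/-- **No valuative flip on `≤ k`-row shapes, given that `k`-letter forms are border-determinantal.**
Under the same hypothesis on the `k` greatest letters, for every `n ≤ m`, every admissible centre
`(U, r)`, every `δ` and every `λ ⊢ mδ` with `ℓ(λ) ≤ k` (and `ℓ(λ) ≤ m²`): `mult_pp(λ*) ≤ dim T_U(λ)`
(the truncation verbatim; `orbitMultiplicity_paddedPer_le_det_of_topForms_mem_orbitClosure`, the
dual weight lives on the last `ℓ(λ)` letters, and the landed `ValuativeBound_proof`). Row 3 of the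
few-row table is this theorem at `k = 3` modulo the classical fact; rows `≤ 2` are unconditional
(`no_twoRow_flip`). -/
theorem noFlip_of_topForms_mem_orbitClosure {n : ℕ} (m : ℕ) [NeZero m] (hnm : n ≤ m) (k : ℕ)
    (H : ∀ q : MvPolynomial (MatIdx m) ℂ, q.IsHomogeneous m →
      (∀ i ∈ q.vars, m * m ≤ (((matIdxEquiv m).symm i : Fin (m * m)) : ℕ) + k) →
        q ∈ orbitClosure (detFormLex ℂ m))
    (U : Submodule ℂ (MatIdx m → ℂ)) (r : ℕ)
    (hU : ∀ u ∈ U, (Matrix.of fun a b : Fin m => u (toLex (a, b))).rank ≤ r)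
    (δ : ℕ) (lam : Nat.Partition (m * δ)) (hk : lam.parts.card ≤ k) (hcard : lam.parts.card ≤ m * m) :
    let χ : Literature.NumberTheory.DiophantineGeometry.Weight (Literature.NumberTheory.DiophantineGeometry.MatIdx m) := (Literature.NumberTheory.DiophantineGeometry.Weight.dualOfPartition (m * m) lam).toMatIdx; let T : Submodule ℂ (MvPolynomial (Literature.NumberTheory.DiophantineGeometry.MatIdx m × Literature.NumberTheory.DiophantineGeometry.MatIdx m) ℂ) := MvPolynomial.homogeneousSubmodule (Literature.NumberTheory.DiophantineGeometry.MatIdx m × Literature.NumberTheory.DiophantineGeometry.MatIdx m) ℂ (m * δ) ⊓ ((MvPolynomial.vanishingIdeal ℂ {p : Literature.NumberTheory.DiophantineGeometry.MatIdx m × Literature.NumberTheory.DiophantineGeometry.MatIdx m → ℂ | ∀ j : Literature.NumberTheory.DiophantineGeometry.MatIdx m, (fun i => p (j, i)) ∈ U}) ^ (δ * (m - r))).restrictScalars ℂ ⊓ (⨅ (M : Matrix (Literature.NumberTheory.DiophantineGeometry.MatIdx m) (Literature.NumberTheory.DiophantineGeometry.MatIdx m) ℂ) (_ : Literature.Computability.AlgebraicComplexity.linSubst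 (Literature.NumberTheory.DiophantineGeometry.MatIdx m) ℂ M (Literature.NumberTheory.DiophantineGeometry.detFormLex ℂ m) = Literature.NumberTheory.DiophantineGeometry.detFormLex ℂ m), LinearMap.ker ((MvPolynomial.aeval (R := ℂ) fun p : Literature.NumberTheory.DiophantineGeometry.MatIdx m × Literature.NumberTheory.DiophantineGeometry.MatIdx m => ∑ l : Literature.NumberTheory.DiophantineGeometry.MatIdx m, M l p.2 • MvPolynomial.X (p.1, l)).toLinearMap - LinearMap.id (R := ℂ) (M := MvPolynomial (Literature.NumberTheory.DiophantineGeometry.MatIdx m × Literature.NumberTheory.DiophantineGeometry.MatIdx m) ℂ))) ⊓ (⨅ (g : Matrix.GeneralLinearGroup (Literature.NumberTheory.DiophantineGeometry.MatIdx m) ℂ) (_ : Literature.NumberTheory.DiophantineGeometry.IsUpperTriangular g), LinearMap.ker ((MvPolynomial.aeval (R := ℂ) fun p : Literature.NumberTheory.DiophantineGeometry.MatIdx m × Literature.NumberTheory.DiophantineGeometry.MatIdx m => ∑ l : Literature.NumberTheory.DiophantineGeometry.MatIdx m, ((g⁻¹ : Matrix.GeneralLinearGroup (Literature.NumberTheory.DiophantineGeometry.MatIdx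 m) ℂ) : Matrix (Literature.NumberTheory.DiophantineGeometry.MatIdx m) (Literature.NumberTheory.DiophantineGeometry.MatIdx m) ℂ) p.1 l • MvPolynomial.X (l, p.2)).toLinearMap - Literature.NumberTheory.DiophantineGeometry.weightChar χ g • LinearMap.id (R := ℂ) (M := MvPolynomial (Literature.NumberTheory.DiophantineGeometry.MatIdx m × Literature.NumberTheory.DiophantineGeometry.MatIdx m) ℂ))); Literature.NumberTheory.DiophantineGeometry.orbitMultiplicity ℂ (Literature.NumberTheory.DiophantineGeometry.paddedPerFormLex ℂ n m) m χ ≤ Module.finrank ℂ ↥T := by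
  intro χ T
  refine le_trans ?_ (ValuativeBound.ValuativeBound_proof m U r hU δ lam hcard)
  refine orbitMultiplicity_paddedPer_le_det_of_topForms_mem_orbitClosure hnm k H _ fun i hi => ?_
  obtain ⟨i', rfl⟩ : ∃ i' : Fin (m * m), matIdxEquiv m i' = i :=
    ⟨(matIdxEquiv m).symm i, (matIdxEquiv m).apply_symm_apply i⟩
  refine NoValuativeFlip.dualOfPartition_toMatIdx_eq_zero_of_lt lam i' ?_
  simp only [OrderIso.symm_apply_apply] at hi
  omega

end TopForms



end Summit.ValiantsHypothesis.ValiantsHypothesis.Theorems.ValuativeFlip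

end
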